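import Literature.NumberTheory.ConnesConsani2023.ZetaCyclesSemilocalForm
import Literature.NumberTheory.LFunctions.WeilGroundState
import Literature.NumberTheory.LFunctions.WeilMellinInversion
import Literature.Analysis.SpecialFunctions.DigammaVerticalAsymptotics
import Literature.Analysis.FunctionSpaces.PlancherelL1L2
import HarnessLib

/-!
# Proofs for `ZetaCyclesSemilocalForm`: lower boundedness and lower semicontinuity of `QW_λ` on `L²`

RH-FREE (label, line 1).  Sibling proof file of
`Literature/NumberTheory/ConnesConsani2023/ZetaCyclesSemilocalForm.lean` (Connes–Consani, *Spectral
triples and ζ-cycles*, Enseign. Math. **69** (2023), §2.1.2 [cite: ConnesConsani2023, Prop. 2.1 p. 103]).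
It DISCHARGES the named fact `prop_2_1` (`theorem prop_2_1_holds : prop_2_1`, §H): the `L²`-extension
clause of Prop. 2.1 — the extended form `semilocalWeilForm a` (`QW_λ`, `a = log λ`, values in `(−∞, +∞]`)
is LOWER BOUNDED and LOWER SEMICONTINUOUS on the window-supported square-integrable functions — following
the printed argument (p. 103–104, arXiv chunk p0006:L68–L85): every term of (2.11) except `Q_∞` is
`L²`-bounded (polar term = rank two `|h⟩⟨h^*| + |h^*⟩⟨h|`, prime terms = bounded `V(n)`), and `Q_∞` has a
weight `∂_tθ` bounded below and `→ +∞` like `½ log|t|` (p. 105), so that `Q_∞` is a non-negative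
perturbation (lower semicontinuous by Fatou) of an `L²`-continuous form.

Contents (all PROVED; three `private` plumbing abbreviations `sqm`, `archE`, `bpart`; no named fact):
* §A weights: `|ρ_N(t)| ≤ Σ_{n≤N} 2Λ(n)/√n`; two-sided comparison of `Re ψ(1/4+it/2) − ψ(1/4)` with
  the log weight `1 + log(1+t²)` (from `ψ(1/4+iy) = log(1+|y|) + O(1)`,
  `Literature.Analysis.SpecialFunctions.Complex.exists_norm_digamma_sub_log_le_of_pos`), whence the
  form domain `{‖ξ̂‖₁ < ∞}` of `ZetaCyclesSemilocalForm` IS `{Q_∞ < ∞}` (§F).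
* §B window-supported `L²` functions: integrable; Cauchy–Schwarz `(∫|ξ|)² ≤ 2a ∫|ξ|²`; the polar
  values `|ξ̂(σ)| ≤ e^{|σ−1/2| a} ∫|ξ|`, `|2 Re(ξ̂(0) conj ξ̂(1))| ≤ 4a e^a ‖ξ‖₂²`.
* §C Plancherel in the `weilMellin` normalisation for `L¹ ∩ L²`: `∫|ξ̂(1/2+it)|² dt = 2π ∫|ξ|²`
  (from `Literature.Analysis.FunctionSpaces.PlancherelL1L2`).
* §D `semilocalWeilForm_lower_bound`: clause (i) — `∃ c, −c‖ξ‖₂² ≤ QW_λ(ξ)` on the window.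
* §E–§G: `L²`-continuity of the bounded part (`tendsto_bpart`: polar values, `‖·‖₂²`, and the bounded
  weight `ψ(1/4) − ρ_N` via `∫ | |û_n|² − |ξ̂|² | → 0`), and Fatou for the archimedean energy
  (`archE_le_liminf`, pointwise convergence `û_n(1/2+it) → ξ̂(1/2+it)` from `L¹` convergence).
* §H `semilocalWeilForm_le_liminf` (clause (ii)) and `prop_2_1_holds`.
* §I continuity of `E_N` / `QW_λ` on the form domain for the GRAPH NORM of Lemma 2.2: energy
  convergence `‖(u_n − ξ)^‖₁² → 0` implies `L²` convergence (`2π‖η‖₂² ≤ ‖η̂‖₁²`, Plancherel) and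
  `E_N(u_n) → E_N(ξ)` (`tendsto_weilFinitePrimeQuadratic_of_energy`; the step «F is continuous on
  Dom(Q^N_{W,λ}) for the graph norm» of the proof of Prop. 2.3, p. 106).
Nothing here bears on the truth of the Riemann hypothesis.
-/

noncomputable section

open Complex Filter Set MeasureTheory
open scoped Real Topology ENNReal ComplexConjugate FourierTransform

namespace Literature.NumberTheory.ConnesConsani2023

open Literature.NumberTheory.LFunctions
open Literature.Analysis.SpecialFunctions (reDigammaQuarter reDigammaQuarter_zero_le)

/-! ## §A The weights -/

/-- `|ρ_N(t)| ≤ Σ_{n ≤ N} 2Λ(n)/√n`: the prime ripple is bounded (the operators `V(n)` of (2.12) are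
bounded, p. 103). [cite: ConnesConsani2023, proof of Prop. 2.1 (V(n) bounded; arXiv chunk p0006:L79–L81; p. 104)] -/
theorem abs_weilPrimeRipple_le (N : ℕ) (t : ℝ) :
    |weilPrimeRipple N t| ≤
      ∑ n ∈ Finset.range (N + 1), (ArithmeticFunction.vonMangoldt n : ℝ) / Real.sqrt n * 2 := by
  unfold weilPrimeRipple
  refine (Finset.abs_sum_le_sum_abs _ _).trans (Finset.sum_le_sum fun n _ ↦ ?_)
  have h0 : 0 ≤ (ArithmeticFunction.vonMangoldt n : ℝ) / Real.sqrt n :=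
    div_nonneg ArithmeticFunction.vonMangoldt_nonneg (Real.sqrt_nonneg _)
  rw [abs_mul, abs_of_nonneg h0]
  refine mul_le_mul_of_nonneg_left ?_ h0
  rw [abs_mul, abs_two]
  have := Real.abs_cos_le_one (t * Real.log n)
  linarith

/-- Upper comparison of the archimedean weight with the log weight:
`Re ψ(1/4+it/2) − ψ(1/4) ≤ K (1 + log(1+t²))` (from `∂_tθ(t) = ½ log|t| + O(1)`, p. 105 / p0007:L19).
[cite: ConnesConsani2023, proof of Lemma 2.2, asymptotic expansion of ∂θ (arXiv chunk p0007:L16–L22; p. 104–105)] -/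
theorem exists_reDigammaQuarter_sub_le_logWeight :
    ∃ K : ℝ, 0 < K ∧ ∀ t : ℝ,
      reDigammaQuarter t - reDigammaQuarter 0 ≤ K * (1 + Real.log (1 + t ^ 2)) := by
  obtain ⟨C, hC⟩ :=
    Literature.Analysis.SpecialFunctions.Complex.exists_norm_digamma_sub_log_le_of_pos
      (a := 1 / 4) (by norm_num)
  have hup : ∀ t : ℝ, reDigammaQuarter t ≤ Real.log (1 + |t / 2|) + C := by
    intro t
    have h := hC (t / 2)
    have e : ((1 / 4 : ℝ) : ℂ) + ((t / 2 : ℝ) : ℂ) * I = 1 / 4 + t / 2 * I := by push_cast; ring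
    rw [e] at h
    have hre := (Complex.abs_re_le_norm
      (Complex.digamma (1 / 4 + t / 2 * I) - (Real.log (1 + |t / 2|) : ℂ))).trans h
    rw [Complex.sub_re, Complex.ofReal_re] at hre
    have := (abs_le.1 hre).2
    show (Complex.digamma (1 / 4 + t / 2 * I)).re ≤ _
    linarith
  refine ⟨|C| + |reDigammaQuarter 0| + 1, by positivity, fun t ↦ ?_⟩
  have hL : 0 ≤ Real.log (1 + t ^ 2) := Real.log_nonneg (by nlinarith [sq_nonneg t])
  have h1 : Real.log (1 + |t / 2|) ≤ Real.log 2 + Real.log (1 + t ^ 2) := by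
    rw [← Real.log_mul (by norm_num) (by positivity)]
    refine Real.log_le_log (by positivity) ?_
    rw [abs_div, abs_two]
    nlinarith [abs_nonneg t, sq_abs t, sq_nonneg (|t| - 1)]
  have hlog2 : Real.log 2 ≤ 1 := by
    have := Real.log_two_lt_d9
    linarith
  have hK : 0 ≤ (|C| + |reDigammaQuarter 0|) * Real.log (1 + t ^ 2) := by positivity
  nlinarith [hup t, le_abs_self C, neg_abs_le (reDigammaQuarter 0)]

/-- Lower comparison: `1 + log(1+t²) ≤ 2 (Re ψ(1/4+it/2) − ψ(1/4)) + K`. [cite: ConnesConsani2023, proof of Lemma 2.2, asymptotic expansion of ∂θ (arXiv chunk p0007:L16–L22; p. 104–105)] -/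
theorem exists_logWeight_le_reDigammaQuarter_sub :
    ∃ K : ℝ, ∀ t : ℝ,
      1 + Real.log (1 + t ^ 2) ≤ 2 * (reDigammaQuarter t - reDigammaQuarter 0) + K := by
  obtain ⟨C, hC⟩ :=
    Literature.Analysis.SpecialFunctions.Complex.exists_norm_digamma_sub_log_le_of_pos
      (a := 1 / 4) (by norm_num)
  have hlow : ∀ t : ℝ, Real.log (1 + |t / 2|) - C ≤ reDigammaQuarter t := by
    intro t
    have h := hC (t / 2)
    have e : ((1 / 4 : ℝ) : ℂ) + ((t / 2 : ℝ) : ℂ) * I = 1 / 4 + t / 2 * I := by push_cast; ring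
    rw [e] at h
    have hre := (Complex.abs_re_le_norm
      (Complex.digamma (1 / 4 + t / 2 * I) - (Real.log (1 + |t / 2|) : ℂ))).trans h
    rw [Complex.sub_re, Complex.ofReal_re] at hre
    have := (abs_le.1 hre).1
    show _ ≤ (Complex.digamma (1 / 4 + t / 2 * I)).re
    linarith
  refine ⟨1 + Real.log 4 + 2 * C + 2 * reDigammaQuarter 0, fun t ↦ ?_⟩
  have hprod : Real.log (4 * (1 + |t / 2|) ^ 2) = Real.log 4 + 2 * Real.log (1 + |t / 2|) := by
    rw [Real.log_mul (by norm_num) (by positivity), Real.log_pow]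
    push_cast
    ring
  have h1 : Real.log (1 + t ^ 2) ≤ Real.log (4 * (1 + |t / 2|) ^ 2) := by
    refine Real.log_le_log (by positivity) ?_
    rw [abs_div, abs_two]
    nlinarith [abs_nonneg t, sq_abs t]
  linarith [hlow t]

/-! ## §B Window-supported square-integrable functions -/

section Window

variable {a : ℝ} {ξ : ℝ → ℂ}

/-- A window-supported function vanishes off the window. [cite: ConnesConsani2023, Prop. 2.1 (L²([λ⁻¹,λ]) as the subspace of functions vanishing outside; arXiv chunk p0006:L68; p. 103)] -/
theorem eq_zero_of_support_subset (hsupp : Function.support ξ ⊆ Icc (-a) a) {x : ℝ}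
    (hx : x ∉ Icc (-a) a) : ξ x = 0 :=
  Function.support_subset_iff'.1 hsupp x hx

/-- `L²` functions on the window are integrable (`L² ⊆ L¹` on a set of finite measure). [cite: ConnesConsani2023, Prop. 2.1 (the Hilbert space L²([λ⁻¹,λ], d*u); arXiv chunk p0006:L55; p. 103)] -/
theorem integrable_of_memLp_window (hξ : MemLp ξ 2 volume)
    (hsupp : Function.support ξ ⊆ Icc (-a) a) : Integrable ξ := by
  rw [← integrableOn_iff_integrable_of_support_subset hsupp]
  exact (hξ.restrict (Icc (-a) a)).integrable one_le_two

/-- `∫ |ξ|²` is a genuine integral for `ξ ∈ L²`. [cite: ConnesConsani2023, Prop. 2.1 (the Hilbert space L²([λ⁻¹,λ], d*u); arXiv chunk p0006:L55; p. 103)] -/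
theorem integrable_norm_sq_of_memLp (hξ : MemLp ξ 2 volume) :
    Integrable fun x ↦ ‖ξ x‖ ^ 2 :=
  (memLp_two_iff_integrable_sq_norm hξ.1).1 hξ

/-- **Cauchy–Schwarz on the window**: `(∫ |ξ|)² ≤ 2a ∫ |ξ|²` for `ξ` supported in `[−a, a]`,
`a > 0` (variance trick `∫ (|ξ| − μ)² ≥ 0`). [cite: ConnesConsani2023, proof of Prop. 2.1 (Cauchy–Schwarz, arXiv chunk p0006:L79; p. 104)] -/
theorem sq_integral_norm_le (hξ : MemLp ξ 2 volume) (hsupp : Function.support ξ ⊆ Icc (-a) a)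
    (ha : 0 < a) : (∫ x, ‖ξ x‖) ^ 2 ≤ 2 * a * ∫ x, ‖ξ x‖ ^ 2 := by
  set L : ℝ := ∫ x, ‖ξ x‖ with hL
  set μ : ℝ := L / (2 * a) with hμ
  have hint : Integrable ξ := integrable_of_memLp_window hξ hsupp
  have hzero : ∀ x, x ∉ Icc (-a) a → ξ x = 0 := fun x hx ↦ eq_zero_of_support_subset hsupp hx
  have i1 : ∫ x in Icc (-a) a, ‖ξ x‖ = L := by
    rw [hL]
    exact setIntegral_eq_integral_of_forall_compl_eq_zero fun x hx ↦ by simp [hzero x hx]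
  have i2 : ∫ x in Icc (-a) a, ‖ξ x‖ ^ 2 = ∫ x, ‖ξ x‖ ^ 2 :=
    setIntegral_eq_integral_of_forall_compl_eq_zero fun x hx ↦ by simp [hzero x hx]
  have i3 : ∫ x in Icc (-a) a, (μ ^ 2 : ℝ) = 2 * a * μ ^ 2 := by
    rw [setIntegral_const, smul_eq_mul, Real.volume_real_Icc_of_le (by linarith)]
    ring
  have hint1 : IntegrableOn (fun x ↦ ‖ξ x‖) (Icc (-a) a) := hint.norm.integrableOn
  have hint2 : IntegrableOn (fun x ↦ ‖ξ x‖ ^ 2) (Icc (-a) a) :=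
    (integrable_norm_sq_of_memLp hξ).integrableOn
  have hint3 : IntegrableOn (fun _ ↦ (μ ^ 2 : ℝ)) (Icc (-a) a) :=
    continuous_const.continuousOn.integrableOn_compact isCompact_Icc
  have key : 0 ≤ ∫ x in Icc (-a) a, (‖ξ x‖ - μ) ^ 2 :=
    setIntegral_nonneg measurableSet_Icc fun x _ ↦ sq_nonneg _
  have hexp : ∫ x in Icc (-a) a, (‖ξ x‖ - μ) ^ 2 =
      (∫ x in Icc (-a) a, ‖ξ x‖ ^ 2) - 2 * μ * (∫ x in Icc (-a) a, ‖ξ x‖) +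
        ∫ x in Icc (-a) a, (μ ^ 2 : ℝ) := by
    have e : (fun x ↦ (‖ξ x‖ - μ) ^ 2) = fun x ↦ ‖ξ x‖ ^ 2 - 2 * μ * ‖ξ x‖ + μ ^ 2 := by
      funext x; ring
    have hfg : Integrable (fun x ↦ ‖ξ x‖ ^ 2 - 2 * μ * ‖ξ x‖) (volume.restrict (Icc (-a) a)) :=
      hint2.sub (hint1.const_mul _)
    rw [e, integral_add hfg hint3, integral_sub hint2 (hint1.const_mul _), integral_const_mul]
  rw [hexp, i1, i2, i3] at key
  have hμL : 2 * μ * L = L ^ 2 / a := by rw [hμ]; field_simp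
  have hμ2 : 2 * a * μ ^ 2 = L ^ 2 / (2 * a) := by rw [hμ]; field_simp
  rw [hμL, hμ2] at key
  have h2a : 0 < 2 * a := by positivity
  have : L ^ 2 / (2 * a) ≤ ∫ x, ‖ξ x‖ ^ 2 := by
    have e : L ^ 2 / a = 2 * (L ^ 2 / (2 * a)) := by field_simp
    rw [e] at key
    linarith
  rwa [div_le_iff₀ h2a, mul_comm] at this

/-- The polar values of a window function: `|ξ̂(σ)| ≤ e^{|σ − 1/2| a} ∫ |ξ|` for real `σ`
(`ξ̂(i/2) = ⟨h|ξ⟩`, `h(u) = u^{1/2}`, p. 103). [cite: ConnesConsani2023, proof of Prop. 2.1 (f̂(i/2) = ⟨h|f⟩; arXiv chunk p0006:L72–L76; p. 103)] -/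
theorem norm_weilMellin_real_le (hξ : MemLp ξ 2 volume) (hsupp : Function.support ξ ⊆ Icc (-a) a)
    (σ : ℝ) :
    ‖weilMellin ξ σ‖ ≤ Real.exp (|σ - 1 / 2| * a) * ∫ x, ‖ξ x‖ := by
  have hint : Integrable ξ := integrable_of_memLp_window hξ hsupp
  have hzero : ∀ x, x ∉ Icc (-a) a → ξ x = 0 := fun x hx ↦ eq_zero_of_support_subset hsupp hx
  have hpt : ∀ x : ℝ, ‖ξ x * cexp (((σ : ℂ) - 1 / 2) * x)‖ ≤ Real.exp (|σ - 1 / 2| * a) * ‖ξ x‖ := by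
    intro x
    by_cases hx : x ∈ Icc (-a) a
    · rw [norm_mul, Complex.norm_exp, mul_comm]
      refine mul_le_mul_of_nonneg_right (Real.exp_le_exp.2 ?_) (norm_nonneg _)
      have hre : (((σ : ℂ) - 1 / 2) * x).re = (σ - 1 / 2) * x := by
        simp [Complex.mul_re]
      rw [hre]
      calc (σ - 1 / 2) * x ≤ |(σ - 1 / 2) * x| := le_abs_self _
        _ = |σ - 1 / 2| * |x| := abs_mul _ _
        _ ≤ |σ - 1 / 2| * a := mul_le_mul_of_nonneg_left (abs_le.2 ⟨hx.1, hx.2⟩) (abs_nonneg _)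
    · rw [hzero x hx]
      simp only [zero_mul, norm_zero, mul_zero, le_refl]
  unfold weilMellin
  calc ‖∫ t : ℝ, ξ t * cexp (((σ : ℂ) - 1 / 2) * t)‖
      ≤ ∫ t : ℝ, ‖ξ t * cexp (((σ : ℂ) - 1 / 2) * t)‖ := norm_integral_le_integral_norm _
    _ ≤ ∫ t : ℝ, Real.exp (|σ - 1 / 2| * a) * ‖ξ t‖ :=
        integral_mono_of_nonneg (Eventually.of_forall fun _ ↦ norm_nonneg _)
          (hint.norm.const_mul _) (Eventually.of_forall hpt)
    _ = Real.exp (|σ - 1 / 2| * a) * ∫ x, ‖ξ x‖ := integral_const_mul _ _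

/-- The polar term of (2.11) is `L²`-bounded on the window:
`|2 Re(ξ̂(0) conj ξ̂(1))| ≤ 4a e^a ∫|ξ|²` (rank-two bounded operator `T = |h⟩⟨h^*| + |h^*⟩⟨h|`, p. 103).
[cite: ConnesConsani2023, proof of Prop. 2.1 (polar term = ⟨f|Tf⟩ with T of rank two; arXiv chunk p0006:L72–L78; p. 103–104)] -/
theorem abs_polar_le (hξ : MemLp ξ 2 volume) (hsupp : Function.support ξ ⊆ Icc (-a) a)
    (ha : 0 < a) :
    |2 * (weilMellin ξ 0 * conj (weilMellin ξ 1)).re| ≤ 4 * a * Real.exp a * ∫ x, ‖ξ x‖ ^ 2 := by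
  have h0 := norm_weilMellin_real_le hξ hsupp 0
  have h1 := norm_weilMellin_real_le hξ hsupp 1
  rw [show |(0 : ℝ) - 1 / 2| = 1 / 2 by norm_num] at h0
  rw [show |(1 : ℝ) - 1 / 2| = 1 / 2 by norm_num] at h1
  push_cast at h0 h1
  have hL := sq_integral_norm_le hξ hsupp ha
  set L := ∫ x, ‖ξ x‖
  have hLnn : 0 ≤ L := integral_nonneg fun _ ↦ norm_nonneg _
  have hexp : Real.exp (1 / 2 * a) * Real.exp (1 / 2 * a) = Real.exp a := by
    rw [← Real.exp_add]; ring_nf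
  calc |2 * (weilMellin ξ 0 * conj (weilMellin ξ 1)).re|
      ≤ 2 * ‖weilMellin ξ 0 * conj (weilMellin ξ 1)‖ := by
        rw [abs_mul, abs_two]
        exact mul_le_mul_of_nonneg_left (Complex.abs_re_le_norm _) zero_le_two
    _ = 2 * (‖weilMellin ξ 0‖ * ‖weilMellin ξ 1‖) := by rw [norm_mul, Complex.norm_conj]
    _ ≤ 2 * ((Real.exp (1 / 2 * a) * L) * (Real.exp (1 / 2 * a) * L)) := by
        gcongr
    _ = 2 * Real.exp a * L ^ 2 := by rw [← hexp]; ring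
    _ ≤ 2 * Real.exp a * (2 * a * ∫ x, ‖ξ x‖ ^ 2) := by gcongr
    _ = 4 * a * Real.exp a * ∫ x, ‖ξ x‖ ^ 2 := by ring

end Window

/-! ## §C Plancherel in the `weilMellin` normalisation for `L¹ ∩ L²` -/

/-- `𝓕 ξ (w) = ξ̂(1/2 − 2πi w)` (Mathlib's Fourier normalisation vs. `weilMellin`). [cite: ConnesConsani2023, Prop. 2.1 (Fourier transform on ℝ ≃ ℝ̂ after the logarithmic change of variable; arXiv chunk p0007:L9; p. 104)] -/
theorem fourierIntegral_eq_weilMellin (ξ : ℝ → ℂ) (w : ℝ) :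
    𝓕 ξ w = weilMellin ξ (1 / 2 + ((-(2 * π * w) : ℝ) : ℂ) * I) := by
  have h := fourier_weilKernel ξ (1 / 2) w
  have e : (fun t : ℝ ↦ ξ t * cexp ((((1 / 2 : ℝ) : ℂ) - 1 / 2) * t)) = ξ := by
    funext t; push_cast; simp
  rw [e] at h
  rw [h]
  push_cast
  ring_nf

/-- **Plancherel** for window (or any `L¹ ∩ L²`) functions: `∫ |ξ̂(1/2+it)|² dt = 2π ∫ |ξ|²`. [cite: ConnesConsani2023, proof of Lemma 2.2 (Fourier transform on L²([−L/2,L/2]) ⊂ L²(ℝ); arXiv chunk p0007:L9; p. 104)] -/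
theorem integral_norm_sq_weilMellin_half_line_of_memLp {ξ : ℝ → ℂ} (h1 : Integrable ξ)
    (h2 : MemLp ξ 2 volume) :
    ∫ t : ℝ, ‖weilMellin ξ (1 / 2 + t * I)‖ ^ 2 = 2 * π * ∫ x, ‖ξ x‖ ^ 2 := by
  have hP := Literature.Analysis.FunctionSpaces.integral_norm_sq_fourierIntegral_eq h1 h2
  set f : ℝ → ℝ := fun t ↦ ‖weilMellin ξ (1 / 2 + t * I)‖ ^ 2 with hf
  have hsub := Measure.integral_comp_mul_left f (-(2 * π))
  have e1 : (fun w : ℝ ↦ f (-(2 * π) * w)) = fun w ↦ ‖𝓕 ξ w‖ ^ 2 := by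
    funext w
    rw [fourierIntegral_eq_weilMellin, hf]
    simp only
    congr 3
    push_cast
    ring
  rw [e1, hP] at hsub
  have hpi : |(-(2 * π))⁻¹| = (2 * π)⁻¹ := by
    rw [inv_neg, abs_neg, abs_of_pos (by positivity)]
  rw [hpi, smul_eq_mul] at hsub
  have h2pi : (0 : ℝ) < 2 * π := by positivity
  rw [hsub, ← mul_assoc, mul_inv_cancel₀ h2pi.ne', one_mul]

/-- `t ↦ |ξ̂(1/2+it)|²` is integrable for `ξ ∈ L¹ ∩ L²` (Plancherel). [cite: ConnesConsani2023, proof of Lemma 2.2 (Fourier transform on L²([−L/2,L/2]) ⊂ L²(ℝ); arXiv chunk p0007:L9; p. 104)] -/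
theorem integrable_norm_sq_weilMellin_half_line_of_memLp {ξ : ℝ → ℂ} (h1 : Integrable ξ)
    (h2 : MemLp ξ 2 volume) :
    Integrable fun t : ℝ ↦ ‖weilMellin ξ (1 / 2 + t * I)‖ ^ 2 := by
  have hF := Literature.Analysis.FunctionSpaces.memLp_two_fourierIntegral h1 h2
  have i1 : Integrable (fun w ↦ ‖𝓕 ξ w‖ ^ 2) (volume : Measure ℝ) :=
    (memLp_two_iff_integrable_sq_norm hF.1).1 hF
  have hR : -(2 * π)⁻¹ ≠ (0 : ℝ) := neg_ne_zero.2 (inv_ne_zero (by positivity))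
  have i2 := i1.comp_mul_left' (R := -(2 * π)⁻¹) hR
  refine i2.congr (Eventually.of_forall fun t ↦ ?_)
  show ‖𝓕 ξ (-(2 * π)⁻¹ * t)‖ ^ 2 = ‖weilMellin ξ (1 / 2 + t * I)‖ ^ 2
  rw [fourierIntegral_eq_weilMellin]
  congr 3
  push_cast
  field_simp

/-- `t ↦ ξ̂(1/2+it)` is continuous for integrable `ξ`. [cite: ConnesConsani2023, proof of Lemma 2.2 (arXiv chunk p0007:L9; p. 104)] -/
theorem continuous_weilMellin_half_line_of_integrable {ξ : ℝ → ℂ} (h1 : Integrable ξ) :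
    Continuous fun t : ℝ ↦ weilMellin ξ (1 / 2 + t * I) := by
  have hc := Literature.Analysis.FunctionSpaces.continuous_fourierIntegral h1
  have e : (fun t : ℝ ↦ weilMellin ξ (1 / 2 + t * I)) = fun t ↦ 𝓕 ξ (-(2 * π)⁻¹ * t) := by
    funext t
    rw [fourierIntegral_eq_weilMellin]
    congr 2
    push_cast
    field_simp
  rw [e]
  exact hc.comp (by fun_prop)

/-! ## §D Clause (i) of `prop_2_1`: `QW_λ` is lower bounded on `L²([λ⁻¹, λ], d*u)` -/

/-- The finite-prime weight is bounded below: `w_N(t) = Re ψ(1/4+it/2) − ρ_N(t) ≥ ψ(1/4) − Σ_{n≤N} 2Λ(n)/√n`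
(`∂_tθ` is lower bounded, p. 103; the `V(n)` are bounded). [cite: ConnesConsani2023, proof of Prop. 2.1 (∂θ lower bounded, V(n) bounded; arXiv chunk p0006:L68–L81; p. 103–104)] -/
theorem weilFinitePrimeWeight_ge (N : ℕ) (t : ℝ) :
    reDigammaQuarter 0 -
        ∑ n ∈ Finset.range (N + 1), (ArithmeticFunction.vonMangoldt n : ℝ) / Real.sqrt n * 2 ≤
      weilFinitePrimeWeight N t := by
  unfold weilFinitePrimeWeight
  have h1 := reDigammaQuarter_zero_le t
  have h2 := (abs_le.1 (abs_weilPrimeRipple_le N t)).2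
  linarith

/-- **Prop. 2.1, lower boundedness on `L²`** (clause (i) of `prop_2_1`, PROVED): for every window
`[−a, a]`, `a > 0`, there is `c` with `−c ∫|ξ|² ≤ QW_λ(ξ)` for every square-integrable `ξ` supported in
the window (`QW_λ = semilocalWeilForm a`, with values in `(−∞, +∞]`).  Printed argument (p. 103–104):
the polar term is a rank-two bounded operator, the prime terms are bounded, and the archimedean
weight `∂_tθ` is bounded below; here with Plancherel `∫|ξ̂|² = 2π‖ξ‖₂²`.
[cite: ConnesConsani2023, Prop. 2.1 (lower bounded; arXiv chunk p0006:L55–L81; p. 103–104)] -/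
theorem semilocalWeilForm_lower_bound {a : ℝ} (ha : 0 < a) :
    ∃ c : ℝ, ∀ ξ : ℝ → ℂ, MemLp ξ 2 volume → Function.support ξ ⊆ Icc (-a) a →
      ((-(c * ∫ x, ‖ξ x‖ ^ 2) : ℝ) : EReal) ≤ semilocalWeilForm a ξ := by
  set N := primeCutoff a with hN
  set R : ℝ := ∑ n ∈ Finset.range (N + 1), (ArithmeticFunction.vonMangoldt n : ℝ) / Real.sqrt n * 2
    with hR
  have hRnn : 0 ≤ R := Finset.sum_nonneg fun n _ ↦
    mul_nonneg (div_nonneg ArithmeticFunction.vonMangoldt_nonneg (Real.sqrt_nonneg _)) zero_le_two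
  refine ⟨4 * a * Real.exp a + |Real.log π| + (|reDigammaQuarter 0| + R), fun ξ hξ hsupp ↦ ?_⟩
  by_cases hE : logSobolevEnergy ξ < ∞
  · rw [semilocalWeilForm_of_lt_top hE, EReal.coe_le_coe_iff]
    have hint : Integrable ξ := integrable_of_memLp_window hξ hsupp
    have hP := abs_polar_le hξ hsupp ha
    have hPl := integrable_norm_sq_weilMellin_half_line_of_memLp hint hξ
    have hPlanch := integral_norm_sq_weilMellin_half_line_of_memLp hint hξ
    set n2 : ℝ := ∫ x, ‖ξ x‖ ^ 2 with hn2
    have hn2nn : 0 ≤ n2 := integral_nonneg fun _ ↦ by positivity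
    set J : ℝ := ∫ t : ℝ, ‖weilMellin ξ (1 / 2 + t * I)‖ ^ 2 * weilFinitePrimeWeight N t with hJdef
    have hJ : -((|reDigammaQuarter 0| + R) * n2) ≤ 1 / (2 * π) * J := by
      by_cases hI : Integrable
          (fun t : ℝ ↦ ‖weilMellin ξ (1 / 2 + t * I)‖ ^ 2 * weilFinitePrimeWeight N t)
      · have hmono : (reDigammaQuarter 0 - R) * (2 * π * n2) ≤ J := by
          rw [← hPlanch, ← integral_const_mul]
          refine integral_mono (hPl.const_mul _) hI fun t ↦ ?_
          have hw := weilFinitePrimeWeight_ge N t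
          show (reDigammaQuarter 0 - R) * ‖weilMellin ξ (1 / 2 + t * I)‖ ^ 2 ≤
            ‖weilMellin ξ (1 / 2 + t * I)‖ ^ 2 * weilFinitePrimeWeight N t
          rw [mul_comm]
          exact mul_le_mul_of_nonneg_left hw (sq_nonneg _)
        have e1 : 1 / (2 * π) * ((reDigammaQuarter 0 - R) * (2 * π * n2)) =
            (reDigammaQuarter 0 - R) * n2 := by
          field_simp
        have h3 : -((|reDigammaQuarter 0| + R) * n2) ≤ (reDigammaQuarter 0 - R) * n2 := by
          rw [neg_mul_eq_neg_mul]
          exact mul_le_mul_of_nonneg_right (by linarith [neg_abs_le (reDigammaQuarter 0)]) hn2nn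
        have h4 : 1 / (2 * π) * ((reDigammaQuarter 0 - R) * (2 * π * n2)) ≤ 1 / (2 * π) * J :=
          mul_le_mul_of_nonneg_left hmono (by positivity)
        linarith
      · rw [hJdef, integral_undef hI, mul_zero]
        have : 0 ≤ (|reDigammaQuarter 0| + R) * n2 := by positivity
        linarith
    have hpol : -(4 * a * Real.exp a * n2) ≤ 2 * (weilMellin ξ 0 * conj (weilMellin ξ 1)).re :=
      (abs_le.1 hP).1
    have hlog : -(|Real.log π| * n2) ≤ -(Real.log π * n2) := by
      have := mul_le_mul_of_nonneg_right (le_abs_self (Real.log π)) hn2nn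
      linarith
    unfold weilFinitePrimeQuadratic
    show -((4 * a * Real.exp a + |Real.log π| + (|reDigammaQuarter 0| + R)) * n2) ≤
      2 * (weilMellin ξ 0 * conj (weilMellin ξ 1)).re - Real.log π * weilNorm2Sq ξ + 1 / (2 * π) * J
    have hw2 : weilNorm2Sq ξ = n2 := rfl
    rw [hw2]
    nlinarith
  · rw [semilocalWeilForm_of_not_lt_top hE]
    exact le_top

/-! ## §E Towards clause (ii): continuity and semicontinuity pieces -/

section Lsc

variable {a : ℝ}

/-- Window functions against exponential kernels are integrable. [cite: ConnesConsani2023, Prop. 2.1 (f̂(i/2) = ⟨h|f⟩ converges on the window; arXiv chunk p0006:L72–L76; p. 103)] -/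
theorem integrable_mul_cexp_window {η : ℝ → ℂ} (hη : MemLp η 2 volume)
    (hsupp : Function.support η ⊆ Icc (-a) a) (c : ℂ) :
    Integrable fun t : ℝ ↦ η t * cexp (c * t) := by
  have hint : Integrable η := integrable_of_memLp_window hη hsupp
  have hzero : ∀ x, x ∉ Icc (-a) a → η x = 0 := fun x hx ↦ eq_zero_of_support_subset hsupp hx
  refine (hint.norm.const_mul (Real.exp (|c.re| * |a|))).mono'
    (hint.aestronglyMeasurable.mul (by fun_prop : Continuous fun t : ℝ ↦ cexp (c * t)).aestronglyMeasurable)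
    (Eventually.of_forall fun t ↦ ?_)
  by_cases ht : t ∈ Icc (-a) a
  · rw [norm_mul, Complex.norm_exp, mul_comm]
    refine mul_le_mul_of_nonneg_right (Real.exp_le_exp.2 ?_) (norm_nonneg _)
    have hre : (c * (t : ℂ)).re = c.re * t := by simp [Complex.mul_re]
    rw [hre]
    calc c.re * t ≤ |c.re * t| := le_abs_self _
      _ = |c.re| * |t| := abs_mul _ _
      _ ≤ |c.re| * |a| :=
          mul_le_mul_of_nonneg_left ((abs_le.2 ⟨ht.1, ht.2⟩).trans (le_abs_self a)) (abs_nonneg _)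
  · rw [hzero t ht]
    simp only [zero_mul, norm_zero]
    positivity

/-- Linearity of `weilMellin` on window functions: `(u − ξ)^ = û − ξ̂`. [cite: ConnesConsani2023, Prop. 2.1 (QW_λ is a quadratic form on the linear space L²([λ⁻¹,λ]); arXiv chunk p0006:L55; p. 103)] -/
theorem weilMellin_sub_window {u ξ : ℝ → ℂ} (hu : MemLp u 2 volume)
    (husupp : Function.support u ⊆ Icc (-a) a) (hξ : MemLp ξ 2 volume)
    (hξsupp : Function.support ξ ⊆ Icc (-a) a) (s : ℂ) :
    weilMellin (fun t ↦ u t - ξ t) s = weilMellin u s - weilMellin ξ s := by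
  unfold weilMellin
  rw [← integral_sub (integrable_mul_cexp_window hu husupp _) (integrable_mul_cexp_window hξ hξsupp _)]
  congr 1 with t
  ring

/-- A difference of window functions is a window function (support). [cite: ConnesConsani2023, Prop. 2.1 (L²([λ⁻¹,λ]) is a linear space; arXiv chunk p0006:L55; p. 103)] -/
theorem support_sub_subset_window {u ξ : ℝ → ℂ} (husupp : Function.support u ⊆ Icc (-a) a)
    (hξsupp : Function.support ξ ⊆ Icc (-a) a) :
    Function.support (fun t ↦ u t - ξ t) ⊆ Icc (-a) a := by
  intro t ht
  by_contra h
  exact ht (by simp [eq_zero_of_support_subset husupp h, eq_zero_of_support_subset hξsupp h])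

/-- Uniform control of the transform on the critical line by the `L¹` norm:
`|û(1/2+it) − ξ̂(1/2+it)| ≤ ∫ |u − ξ|`. [cite: ConnesConsani2023, proof of Lemma 2.2 (the embedding is continuous; arXiv chunk p0007:L40–L46; p. 105)] -/
theorem norm_weilMellin_half_line_sub_le {u ξ : ℝ → ℂ} (hu : MemLp u 2 volume)
    (husupp : Function.support u ⊆ Icc (-a) a) (hξ : MemLp ξ 2 volume)
    (hξsupp : Function.support ξ ⊆ Icc (-a) a) (t : ℝ) :
    ‖weilMellin u (1 / 2 + t * I) - weilMellin ξ (1 / 2 + t * I)‖ ≤ ∫ x, ‖u x - ξ x‖ := by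
  rw [← weilMellin_sub_window hu husupp hξ hξsupp]
  have hd : MemLp (fun x ↦ u x - ξ x) 2 volume := hu.sub hξ
  have hds := support_sub_subset_window husupp hξsupp
  have h := norm_weilMellin_real_le (ξ := fun x ↦ u x - ξ x) hd hds (1 / 2)
  -- `norm_weilMellin_real_le` is stated for real points; on the critical line the kernel has modulus 1
  have hint : Integrable (fun x ↦ u x - ξ x) := integrable_of_memLp_window hd hds
  unfold weilMellin
  calc ‖∫ x : ℝ, (u x - ξ x) * cexp ((1 / 2 + t * I - 1 / 2) * x)‖
      ≤ ∫ x : ℝ, ‖(u x - ξ x) * cexp ((1 / 2 + t * I - 1 / 2) * x)‖ := norm_integral_le_integral_norm _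
    _ = ∫ x, ‖u x - ξ x‖ := by
        congr 1 with x
        rw [norm_mul, Complex.norm_exp]
        have : ((1 / 2 + (t : ℂ) * I - 1 / 2) * x).re = 0 := by
          simp [Complex.mul_re]
        rw [this, Real.exp_zero, mul_one]

/-- `|√∫|f|² − √∫|h|²| ≤ √∫|f − h|²` (Minkowski in `L²`). [cite: ConnesConsani2023, Prop. 2.1 (the Hilbert space norm; arXiv chunk p0006:L55; p. 103)] -/
theorem abs_sqrt_integral_norm_sq_sub_le {f h : ℝ → ℂ} (hf : MemLp f 2 volume)
    (hh : MemLp h 2 volume) :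
    |Real.sqrt (∫ t, ‖f t‖ ^ 2) - Real.sqrt (∫ t, ‖h t‖ ^ 2)| ≤
      Real.sqrt (∫ t, ‖f t - h t‖ ^ 2) := by
  rw [abs_sub_le_iff]
  constructor
  · -- `√∫|f|² ≤ √∫|h|² + √∫|f−h|²` and `√∫|h|² ≤ √∫|f|² + √∫|f−h|²`, both from Minkowski
    have e3 : (fun t ↦ ‖h t - f t‖ ^ 2) = fun t ↦ ‖f t - h t‖ ^ 2 := by
      funext t; rw [norm_sub_rev]
    have h2 := sqrt_integral_norm_sq_sub_le hf (hf.sub hh)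
    have e4 : (fun t ↦ ‖f t - (f t - h t)‖ ^ 2) = fun t ↦ ‖h t‖ ^ 2 := by
      funext t; congr 2; ring
    simp only [Pi.sub_apply] at h2
    rw [e4] at h2
    -- h2 : √∫|h|² ≤ √∫|f|² + √∫|f - h|²
    have h3 := sqrt_integral_norm_sq_sub_le hh (hh.sub hf)
    have e5 : (fun t ↦ ‖h t - (h t - f t)‖ ^ 2) = fun t ↦ ‖f t‖ ^ 2 := by
      funext t; congr 2; ring
    simp only [Pi.sub_apply] at h3
    rw [e5, e3] at h3
    -- h3 : √∫|f|² ≤ √∫|h|² + √∫|f-h|²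
    linarith
  · have h2 := sqrt_integral_norm_sq_sub_le hf (hf.sub hh)
    have e4 : (fun t ↦ ‖f t - (f t - h t)‖ ^ 2) = fun t ↦ ‖h t‖ ^ 2 := by
      funext t; congr 2; ring
    simp only [Pi.sub_apply] at h2
    rw [e4] at h2
    linarith

end Lsc

/-! ## §F The decomposition `QW_λ = B_N + (1/2π) A` on the form domain -/

section Decomposition

variable {a : ℝ} {η : ℝ → ℂ}

/-- `|η̂(1/2+it)|²` (plumbing abbreviation for this proof file). [folklore] -/
private def sqm (η : ℝ → ℂ) (t : ℝ) : ℝ := ‖weilMellin η (1 / 2 + t * I)‖ ^ 2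

/-- The archimedean energy `A(η) = ∫⁻ |η̂(1/2+it)|² (Re ψ(1/4+it/2) − ψ(1/4)) dt ∈ [0, ∞]` (the part of
`Q_∞` with weight tending to `+∞`; plumbing for this proof file). [folklore] -/
private def archE (η : ℝ → ℂ) : ℝ≥0∞ :=
  ∫⁻ t, ENNReal.ofReal (sqm η t * (reDigammaQuarter t - reDigammaQuarter 0))

/-- The `L²`-bounded part `B_N(η)` of `E_N(η)`: polar term, `−(log π)‖η‖²`, and the bounded weight
`ψ(1/4) − ρ_N(t)` (plumbing for this proof file). [folklore] -/
private def bpart (N : ℕ) (η : ℝ → ℂ) : ℝ :=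
  2 * (weilMellin η 0 * conj (weilMellin η 1)).re - Real.log π * weilNorm2Sq η +
    1 / (2 * π) * ∫ t, sqm η t * (reDigammaQuarter 0 - weilPrimeRipple N t)

/-- `|η̂|² ≥ 0`. [cite: ConnesConsani2023, Prop. 2.1 (plumbing for its proof; arXiv chunk p0006:L55–L81; p. 103–104)] -/
private theorem sqm_nonneg (η : ℝ → ℂ) (t : ℝ) : 0 ≤ sqm η t := sq_nonneg _

/-- `t ↦ |η̂(1/2+it)|²` is continuous for integrable `η`. [cite: ConnesConsani2023, Prop. 2.1 (plumbing for its proof; arXiv chunk p0006:L55–L81; p. 103–104)] -/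
private theorem continuous_sqm (h1 : Integrable η) : Continuous (sqm η) :=
  ((continuous_weilMellin_half_line_of_integrable h1).norm).pow 2

/-- The archimedean weight is measurable. [cite: ConnesConsani2023, Prop. 2.1 (plumbing for its proof; arXiv chunk p0006:L55–L81; p. 103–104)] -/
private theorem measurable_rdq : Measurable reDigammaQuarter :=
  Literature.Analysis.SpecialFunctions.measurable_reDigammaQuarter

/-- The log weight is non-negative. [cite: ConnesConsani2023, Prop. 2.1 (plumbing for its proof; arXiv chunk p0006:L55–L81; p. 103–104)] -/
private theorem logWeight_nonneg (t : ℝ) : 0 ≤ 1 + Real.log (1 + t ^ 2) := by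
  have := Real.log_nonneg (show (1 : ℝ) ≤ 1 + t ^ 2 by nlinarith [sq_nonneg t])
  linarith

/-- `∂θ(t) − ∂θ(0) ≥ 0` (the weight is minimal at `0`). [cite: ConnesConsani2023, Prop. 2.1 (plumbing for its proof; arXiv chunk p0006:L55–L81; p. 103–104)] -/
private theorem rdq_sub_nonneg (t : ℝ) : 0 ≤ reDigammaQuarter t - reDigammaQuarter 0 := by
  linarith [reDigammaQuarter_zero_le t]

/-- Finite log-energy ⇒ finite archimedean energy (`∂θ ≤ K · log`). [cite: ConnesConsani2023, proof of Lemma 2.2 ((2.14) ⇔ (2.16) via the asymptotics of ∂θ; arXiv chunk p0007:L16–L22; p. 105)] -/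
private theorem archE_lt_top_of_energy (hE : logSobolevEnergy η < ∞) : archE η < ∞ := by
  obtain ⟨K, hK, hKb⟩ := exists_reDigammaQuarter_sub_le_logWeight
  have hle : archE η ≤ ENNReal.ofReal K * logSobolevEnergy η := by
    unfold archE logSobolevEnergy
    rw [← lintegral_const_mul' _ _ ENNReal.ofReal_ne_top]
    refine lintegral_mono fun t ↦ ?_
    rw [← ENNReal.ofReal_mul hK.le]
    refine ENNReal.ofReal_le_ofReal ?_
    show sqm η t * _ ≤ K * (‖weilMellin η (1 / 2 + t * I)‖ ^ 2 * _)
    have h0 := sqm_nonneg η t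
    unfold sqm at h0 ⊢
    calc ‖weilMellin η (1 / 2 + t * I)‖ ^ 2 * (reDigammaQuarter t - reDigammaQuarter 0)
        ≤ ‖weilMellin η (1 / 2 + t * I)‖ ^ 2 * (K * (1 + Real.log (1 + t ^ 2))) :=
          mul_le_mul_of_nonneg_left (hKb t) h0
      _ = K * (‖weilMellin η (1 / 2 + t * I)‖ ^ 2 * (1 + Real.log (1 + t ^ 2))) := by ring
  exact hle.trans_lt (ENNReal.mul_lt_top ENNReal.ofReal_lt_top hE)

/-- Finite archimedean energy ⇒ finite log-energy, for `η ∈ L¹ ∩ L²` (`log ≤ 2∂θ + K`, Plancherel). [cite: ConnesConsani2023, proof of Lemma 2.2 ((2.14) ⇔ (2.16) via the asymptotics of ∂θ; arXiv chunk p0007:L16–L22; p. 105)] -/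
private theorem energy_lt_top_of_archE (h1 : Integrable η) (h2 : MemLp η 2 volume)
    (hA : archE η < ∞) : logSobolevEnergy η < ∞ := by
  obtain ⟨K, hKb⟩ := exists_logWeight_le_reDigammaQuarter_sub
  set K₀ := max K 0 with hK₀
  have hK₀nn : 0 ≤ K₀ := le_max_right _ _
  have hKb' : ∀ t, 1 + Real.log (1 + t ^ 2) ≤
      2 * (reDigammaQuarter t - reDigammaQuarter 0) + K₀ := fun t ↦
    (hKb t).trans (by linarith [le_max_left K 0])
  have hm : Integrable (sqm η) := integrable_norm_sq_weilMellin_half_line_of_memLp h1 h2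
  have hmlt : ∫⁻ t, ENNReal.ofReal (sqm η t) < ∞ := hm.lintegral_lt_top
  have hmeas1 : Measurable fun t ↦ ENNReal.ofReal (sqm η t * (reDigammaQuarter t - reDigammaQuarter 0)) :=
    ((continuous_sqm h1).measurable.mul (measurable_rdq.sub measurable_const)).ennreal_ofReal
  have hle : logSobolevEnergy η ≤ 2 * archE η + ENNReal.ofReal K₀ * ∫⁻ t, ENNReal.ofReal (sqm η t) := by
    unfold logSobolevEnergy archE
    rw [← lintegral_const_mul' _ _ ENNReal.ofReal_ne_top, ← lintegral_const_mul _ hmeas1,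
      ← lintegral_add_left (hmeas1.const_mul _)]
    refine lintegral_mono fun t ↦ ?_
    have h0 := sqm_nonneg η t
    have hw := rdq_sub_nonneg t
    rw [show (2 : ℝ≥0∞) = ENNReal.ofReal 2 by norm_num, ← ENNReal.ofReal_mul zero_le_two,
      ← ENNReal.ofReal_mul hK₀nn, ← ENNReal.ofReal_add (by positivity) (by positivity)]
    refine ENNReal.ofReal_le_ofReal ?_
    unfold sqm at h0 ⊢
    calc ‖weilMellin η (1 / 2 + t * I)‖ ^ 2 * (1 + Real.log (1 + t ^ 2))
        ≤ ‖weilMellin η (1 / 2 + t * I)‖ ^ 2 *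
            (2 * (reDigammaQuarter t - reDigammaQuarter 0) + K₀) :=
          mul_le_mul_of_nonneg_left (hKb' t) h0
      _ = 2 * (‖weilMellin η (1 / 2 + t * I)‖ ^ 2 * (reDigammaQuarter t - reDigammaQuarter 0)) +
            K₀ * ‖weilMellin η (1 / 2 + t * I)‖ ^ 2 := by ring
  refine hle.trans_lt ?_
  refine ENNReal.add_lt_top.2 ⟨ENNReal.mul_lt_top (by norm_num) hA, ENNReal.mul_lt_top ENNReal.ofReal_lt_top hmlt⟩

/-- On the form domain, `|η̂|² · (Re ψ(1/4+it/2) − ψ(1/4))` is Bochner integrable. [cite: ConnesConsani2023, proof of Lemma 2.2 (Q_∞(ξ,ξ) < ∞ on the domain; arXiv chunk p0007:L3; p. 104)] -/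
private theorem integrable_sqm_mul_rdq_sub (h1 : Integrable η) (hE : logSobolevEnergy η < ∞) :
    Integrable fun t ↦ sqm η t * (reDigammaQuarter t - reDigammaQuarter 0) := by
  have hmeas : AEStronglyMeasurable
      (fun t ↦ sqm η t * (reDigammaQuarter t - reDigammaQuarter 0)) volume :=
    ((continuous_sqm h1).measurable.mul (measurable_rdq.sub measurable_const)).aestronglyMeasurable
  refine ⟨hmeas, ?_⟩
  rw [hasFiniteIntegral_iff_ofReal (Eventually.of_forall fun t ↦
    mul_nonneg (sqm_nonneg η t) (rdq_sub_nonneg t))]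
  exact archE_lt_top_of_energy hE

/-- `|η̂|²` times a bounded measurable weight is integrable for `η ∈ L¹ ∩ L²`. [cite: ConnesConsani2023, proof of Prop. 2.1 (the bounded terms; arXiv chunk p0006:L79–L81; p. 104)] -/
private theorem integrable_sqm_mul_bdd (h1 : Integrable η) (h2 : MemLp η 2 volume) {v : ℝ → ℝ}
    (hv : Measurable v) {V : ℝ} (hvb : ∀ t, |v t| ≤ V) :
    Integrable fun t ↦ sqm η t * v t := by
  have hm : Integrable (sqm η) := integrable_norm_sq_weilMellin_half_line_of_memLp h1 h2
  have h := hm.bdd_mul (c := V) hv.aestronglyMeasurable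
    (Eventually.of_forall fun t ↦ by rw [Real.norm_eq_abs]; exact hvb t)
  exact h.congr (Eventually.of_forall fun t ↦ mul_comm _ _)

/-- The bounded weight `ψ(1/4) − ρ_N(t)`. [cite: ConnesConsani2023, Prop. 2.1 (plumbing for its proof; arXiv chunk p0006:L55–L81; p. 103–104)] -/
private theorem abs_rdq0_sub_ripple_le (N : ℕ) (t : ℝ) :
    |reDigammaQuarter 0 - weilPrimeRipple N t| ≤
      |reDigammaQuarter 0| +
        ∑ n ∈ Finset.range (N + 1), (ArithmeticFunction.vonMangoldt n : ℝ) / Real.sqrt n * 2 := by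
  have h := abs_weilPrimeRipple_le N t
  calc |reDigammaQuarter 0 - weilPrimeRipple N t|
      ≤ |reDigammaQuarter 0| + |weilPrimeRipple N t| := abs_sub _ _
    _ ≤ _ := by linarith

/-- The prime ripple is measurable. [cite: ConnesConsani2023, Prop. 2.1 (plumbing for its proof; arXiv chunk p0006:L55–L81; p. 103–104)] -/
private theorem measurable_ripple (N : ℕ) : Measurable (weilPrimeRipple N) :=
  (continuous_weilPrimeRipple N).measurable

/-- **Decomposition on the form domain**: `E_N(η) = B_N(η) + (1/2π) A(η)` for `η ∈ L¹ ∩ L²` of finite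
energy. [cite: ConnesConsani2023, Prop. 2.1 eq. (2.11) (the splitting into Q_∞ and bounded terms; arXiv chunk p0006:L55–L81; p. 103–104)] -/
private theorem weilFinitePrimeQuadratic_eq_bpart_add (N : ℕ) (h1 : Integrable η)
    (h2 : MemLp η 2 volume) (hE : logSobolevEnergy η < ∞) :
    weilFinitePrimeQuadratic N η = bpart N η + 1 / (2 * π) * (archE η).toReal := by
  have hiw := integrable_sqm_mul_rdq_sub h1 hE
  have hib := integrable_sqm_mul_bdd h1 h2 (v := fun t ↦ reDigammaQuarter 0 - weilPrimeRipple N t)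
    (measurable_const.sub (measurable_ripple N)) (abs_rdq0_sub_ripple_le N)
  have hsplit : (fun t : ℝ ↦ ‖weilMellin η (1 / 2 + t * I)‖ ^ 2 * weilFinitePrimeWeight N t) =
      fun t ↦ sqm η t * (reDigammaQuarter t - reDigammaQuarter 0) +
        sqm η t * (reDigammaQuarter 0 - weilPrimeRipple N t) := by
    funext t
    unfold weilFinitePrimeWeight sqm
    ring
  have hA : ∫ t, sqm η t * (reDigammaQuarter t - reDigammaQuarter 0) = (archE η).toReal := by
    unfold archE
    exact integral_eq_lintegral_of_nonneg_ae
      (Eventually.of_forall fun t ↦ mul_nonneg (sqm_nonneg η t) (rdq_sub_nonneg t)) hiw.1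
  unfold weilFinitePrimeQuadratic bpart
  rw [hsplit, integral_add hiw hib, hA]
  ring

end Decomposition

/-! ## §G Continuity of the bounded part and Fatou for the archimedean energy -/

section Continuity

variable {a : ℝ} {ξ : ℝ → ℂ} {u : ℕ → ℝ → ℂ}

/-- `L²` convergence on the window implies `L¹` convergence. [cite: ConnesConsani2023, proof of Lemma 2.2 (continuity of the embedding; arXiv chunk p0007:L40–L46; p. 105)] -/
private theorem tendsto_integral_norm_sub (ha : 0 < a) (hξ : MemLp ξ 2 volume)
    (hξs : Function.support ξ ⊆ Icc (-a) a)
    (hu : ∀ n, MemLp (u n) 2 volume ∧ Function.support (u n) ⊆ Icc (-a) a)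
    (hconv : Tendsto (fun n ↦ ∫ x, ‖u n x - ξ x‖ ^ 2) atTop (𝓝 0)) :
    Tendsto (fun n ↦ ∫ x, ‖u n x - ξ x‖) atTop (𝓝 0) := by
  have hbound : ∀ n, (∫ x, ‖u n x - ξ x‖) ≤ Real.sqrt (2 * a * ∫ x, ‖u n x - ξ x‖ ^ 2) := by
    intro n
    have hd : MemLp (fun x ↦ u n x - ξ x) 2 volume := (hu n).1.sub hξ
    have hds := support_sub_subset_window (hu n).2 hξs
    exact (le_abs_self _).trans (Real.abs_le_sqrt (sq_integral_norm_le hd hds ha))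
  have hlim : Tendsto (fun n ↦ Real.sqrt (2 * a * ∫ x, ‖u n x - ξ x‖ ^ 2)) atTop (𝓝 0) := by
    have h := (hconv.const_mul (2 * a)).sqrt
    simpa using h
  exact squeeze_zero (fun n ↦ integral_nonneg fun _ ↦ norm_nonneg _) hbound hlim

/-- The polar values converge: `û_n(σ) → ξ̂(σ)` (`σ` real). [cite: ConnesConsani2023, proof of Prop. 2.1 (f̂(i/2) = ⟨h|f⟩ is a bounded functional; arXiv chunk p0006:L72–L78; p. 103)] -/
private theorem tendsto_weilMellin_real (ha : 0 < a) (hξ : MemLp ξ 2 volume)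
    (hξs : Function.support ξ ⊆ Icc (-a) a)
    (hu : ∀ n, MemLp (u n) 2 volume ∧ Function.support (u n) ⊆ Icc (-a) a)
    (hconv : Tendsto (fun n ↦ ∫ x, ‖u n x - ξ x‖ ^ 2) atTop (𝓝 0)) (σ : ℝ) :
    Tendsto (fun n ↦ weilMellin (u n) σ) atTop (𝓝 (weilMellin ξ σ)) := by
  rw [tendsto_iff_norm_sub_tendsto_zero]
  have hd := tendsto_integral_norm_sub ha hξ hξs hu hconv
  refine squeeze_zero (g := fun n ↦ Real.exp (|σ - 1 / 2| * a) * ∫ x, ‖u n x - ξ x‖)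
    (fun n ↦ norm_nonneg _) (fun n ↦ ?_) (by simpa using hd.const_mul (Real.exp (|σ - 1 / 2| * a)))
  have hdn : MemLp (fun x ↦ u n x - ξ x) 2 volume := (hu n).1.sub hξ
  rw [← weilMellin_sub_window (hu n).1 (hu n).2 hξ hξs]
  exact norm_weilMellin_real_le hdn (support_sub_subset_window (hu n).2 hξs) σ

/-- The `L²` norms converge. [cite: ConnesConsani2023, Prop. 2.1 (the Hilbert space norm; arXiv chunk p0006:L55; p. 103)] -/
private theorem tendsto_weilNorm2Sq (hξ : MemLp ξ 2 volume)
    (hu : ∀ n, MemLp (u n) 2 volume ∧ Function.support (u n) ⊆ Icc (-a) a)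
    (hconv : Tendsto (fun n ↦ ∫ x, ‖u n x - ξ x‖ ^ 2) atTop (𝓝 0)) :
    Tendsto (fun n ↦ weilNorm2Sq (u n)) atTop (𝓝 (weilNorm2Sq ξ)) := by
  have hs : Tendsto (fun n ↦ Real.sqrt (∫ x, ‖u n x‖ ^ 2)) atTop
      (𝓝 (Real.sqrt (∫ x, ‖ξ x‖ ^ 2))) := by
    rw [tendsto_iff_norm_sub_tendsto_zero]
    refine squeeze_zero (fun n ↦ norm_nonneg _) (fun n ↦ ?_) (by simpa using hconv.sqrt)
    rw [Real.norm_eq_abs]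
    exact abs_sqrt_integral_norm_sq_sub_le (hu n).1 hξ
  have e : ∀ η : ℝ → ℂ, weilNorm2Sq η = (Real.sqrt (∫ x, ‖η x‖ ^ 2)) ^ 2 := fun η ↦
    (Real.sq_sqrt (integral_nonneg fun _ ↦ by positivity)).symm
  rw [e ξ]
  simp_rw [e]
  exact hs.pow 2

/-- `| |α|² − |β|² | ≤ (1 + 1/δ)|α − β|² + δ|β|²` (`δ > 0`). [folklore] -/
private theorem abs_sq_norm_sub_sq_norm_le (α β : ℂ) {δ : ℝ} (hδ : 0 < δ) :
    |‖α‖ ^ 2 - ‖β‖ ^ 2| ≤ (1 + 1 / δ) * ‖α - β‖ ^ 2 + δ * ‖β‖ ^ 2 := by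
  have hd : |‖α‖ - ‖β‖| ≤ ‖α - β‖ := abs_norm_sub_norm_le α β
  have h1 : |‖α‖ ^ 2 - ‖β‖ ^ 2| = |‖α‖ - ‖β‖| * (‖α‖ + ‖β‖) := by
    rw [sq_sub_sq, abs_mul, abs_of_nonneg (by positivity : 0 ≤ ‖α‖ + ‖β‖)]
    ring
  rw [h1]
  set d := ‖α - β‖ with hd_def
  have hsum : ‖α‖ + ‖β‖ ≤ d + 2 * ‖β‖ := by linarith [norm_sub_norm_le α β]
  have hamgm : 2 * d * ‖β‖ ≤ d ^ 2 / δ + δ * ‖β‖ ^ 2 := by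
    have key : d ^ 2 / δ + δ * ‖β‖ ^ 2 - 2 * d * ‖β‖ = (d - δ * ‖β‖) ^ 2 / δ := by
      field_simp
      ring
    have : 0 ≤ (d - δ * ‖β‖) ^ 2 / δ := div_nonneg (sq_nonneg _) hδ.le
    linarith
  calc |‖α‖ - ‖β‖| * (‖α‖ + ‖β‖) ≤ d * (d + 2 * ‖β‖) :=
        mul_le_mul hd hsum (by positivity) (norm_nonneg _)
    _ = d ^ 2 + 2 * d * ‖β‖ := by ring
    _ ≤ d ^ 2 + (d ^ 2 / δ + δ * ‖β‖ ^ 2) := by linarith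
    _ = (1 + 1 / δ) * d ^ 2 + δ * ‖β‖ ^ 2 := by ring

/-- `∫ | |û_n|² − |ξ̂|² | dt → 0` (Plancherel on `u_n − ξ`). [cite: ConnesConsani2023, proof of Lemma 2.2 (Plancherel on L²([−L/2,L/2]); arXiv chunk p0007:L9; p. 104)] -/
private theorem tendsto_integral_abs_sqm_sub (hξ : MemLp ξ 2 volume)
    (hξs : Function.support ξ ⊆ Icc (-a) a)
    (hu : ∀ n, MemLp (u n) 2 volume ∧ Function.support (u n) ⊆ Icc (-a) a)
    (hconv : Tendsto (fun n ↦ ∫ x, ‖u n x - ξ x‖ ^ 2) atTop (𝓝 0)) :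
    Tendsto (fun n ↦ ∫ t, |sqm (u n) t - sqm ξ t|) atTop (𝓝 0) := by
  rw [Metric.tendsto_atTop]
  intro ε hε
  have hξ1 := integrable_of_memLp_window hξ hξs
  set S : ℝ := ∫ x, ‖ξ x‖ ^ 2 with hSdef
  have hS : 0 ≤ S := integral_nonneg fun _ ↦ by positivity
  set δ : ℝ := ε / (2 * (2 * π * S + 1)) with hδ
  have h2πS : 0 ≤ 2 * π * S := by positivity
  have hδpos : 0 < δ := by positivity
  have hδS : δ * (2 * π * S) ≤ ε / 2 := by
    rw [hδ, div_mul_eq_mul_div, div_le_iff₀ (by positivity)]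
    nlinarith
  have hev : ∀ᶠ n in atTop, (1 + 1 / δ) * (2 * π * ∫ x, ‖u n x - ξ x‖ ^ 2) < ε / 2 := by
    have ht : Tendsto (fun n ↦ (1 + 1 / δ) * (2 * π * ∫ x, ‖u n x - ξ x‖ ^ 2)) atTop (𝓝 0) := by
      simpa using (hconv.const_mul (2 * π)).const_mul (1 + 1 / δ)
    exact ht.eventually (gt_mem_nhds (by positivity))
  obtain ⟨N, hN⟩ := eventually_atTop.1 hev
  refine ⟨N, fun n hn ↦ ?_⟩
  rw [dist_zero_right, Real.norm_eq_abs, abs_of_nonneg (integral_nonneg fun _ ↦ abs_nonneg _)]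
  have hd : MemLp (fun x ↦ u n x - ξ x) 2 volume := (hu n).1.sub hξ
  have hds := support_sub_subset_window (hu n).2 hξs
  have hd1 := integrable_of_memLp_window hd hds
  have hPd := integral_norm_sq_weilMellin_half_line_of_memLp hd1 hd
  have hPξ := integral_norm_sq_weilMellin_half_line_of_memLp hξ1 hξ
  have hId := integrable_norm_sq_weilMellin_half_line_of_memLp hd1 hd
  have hIξ := integrable_norm_sq_weilMellin_half_line_of_memLp hξ1 hξ
  have hpt : ∀ t, |sqm (u n) t - sqm ξ t| ≤
      (1 + 1 / δ) * ‖weilMellin (fun x ↦ u n x - ξ x) (1 / 2 + t * I)‖ ^ 2 +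
        δ * ‖weilMellin ξ (1 / 2 + t * I)‖ ^ 2 := by
    intro t
    rw [weilMellin_sub_window (hu n).1 (hu n).2 hξ hξs]
    exact abs_sq_norm_sub_sq_norm_le _ _ hδpos
  calc ∫ t, |sqm (u n) t - sqm ξ t|
      ≤ ∫ t : ℝ, ((1 + 1 / δ) * ‖weilMellin (fun x ↦ u n x - ξ x) (1 / 2 + t * I)‖ ^ 2 +
          δ * ‖weilMellin ξ (1 / 2 + t * I)‖ ^ 2) :=
        integral_mono_of_nonneg (Eventually.of_forall fun _ ↦ abs_nonneg _)
          ((hId.const_mul _).add (hIξ.const_mul _)) (Eventually.of_forall hpt)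
    _ = (1 + 1 / δ) * (2 * π * ∫ x, ‖u n x - ξ x‖ ^ 2) + δ * (2 * π * S) := by
        rw [integral_add (hId.const_mul _) (hIξ.const_mul _), integral_const_mul, integral_const_mul,
          hPd, hPξ]
    _ < ε / 2 + ε / 2 := add_lt_add_of_lt_of_le (hN n hn) hδS
    _ = ε := by ring

/-- `∫ |û_n|² v → ∫ |ξ̂|² v` for a bounded weight `v`. [cite: ConnesConsani2023, proof of Prop. 2.1 (the bounded terms are continuous on L²; arXiv chunk p0006:L79–L81; p. 104)] -/
private theorem tendsto_integral_sqm_mul_bdd (hξ : MemLp ξ 2 volume)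
    (hξs : Function.support ξ ⊆ Icc (-a) a)
    (hu : ∀ n, MemLp (u n) 2 volume ∧ Function.support (u n) ⊆ Icc (-a) a)
    (hconv : Tendsto (fun n ↦ ∫ x, ‖u n x - ξ x‖ ^ 2) atTop (𝓝 0)) {v : ℝ → ℝ}
    (hv : Measurable v) {V : ℝ} (hvb : ∀ t, |v t| ≤ V) :
    Tendsto (fun n ↦ ∫ t, sqm (u n) t * v t) atTop (𝓝 (∫ t, sqm ξ t * v t)) := by
  rw [tendsto_iff_norm_sub_tendsto_zero]
  have hV : 0 ≤ V := (abs_nonneg _).trans (hvb 0)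
  have h0 := tendsto_integral_abs_sqm_sub hξ hξs hu hconv
  refine squeeze_zero (fun n ↦ norm_nonneg _) (fun n ↦ ?_) (by simpa using h0.const_mul V)
  have hu1 := integrable_of_memLp_window (hu n).1 (hu n).2
  have hξ1 := integrable_of_memLp_window hξ hξs
  have hIn := integrable_sqm_mul_bdd hu1 (hu n).1 hv hvb
  have hIξ := integrable_sqm_mul_bdd hξ1 hξ hv hvb
  have hmn := integrable_norm_sq_weilMellin_half_line_of_memLp hu1 (hu n).1
  have hmξ := integrable_norm_sq_weilMellin_half_line_of_memLp hξ1 hξ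
  rw [← integral_sub hIn hIξ, Real.norm_eq_abs]
  calc |∫ t, (sqm (u n) t * v t - sqm ξ t * v t)|
      ≤ ∫ t, |sqm (u n) t * v t - sqm ξ t * v t| := abs_integral_le_integral_abs
    _ ≤ ∫ t, V * |sqm (u n) t - sqm ξ t| := by
        refine integral_mono_of_nonneg (Eventually.of_forall fun _ ↦ abs_nonneg _)
          ((hmn.sub hmξ).abs.const_mul V) (Eventually.of_forall fun t ↦ ?_)
        show |sqm (u n) t * v t - sqm ξ t * v t| ≤ V * |sqm (u n) t - sqm ξ t|
        rw [← sub_mul, abs_mul, mul_comm]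
        exact mul_le_mul_of_nonneg_right (hvb t) (abs_nonneg _)
    _ = V * ∫ t, |sqm (u n) t - sqm ξ t| := integral_const_mul _ _

/-- **Continuity of the bounded part** `B_N` along `u_n → ξ` in `L²`. [cite: ConnesConsani2023, proof of Prop. 2.1 (all terms except Q_∞ are bounded; arXiv chunk p0006:L79–L85; p. 104)] -/
private theorem tendsto_bpart (ha : 0 < a) (hξ : MemLp ξ 2 volume)
    (hξs : Function.support ξ ⊆ Icc (-a) a)
    (hu : ∀ n, MemLp (u n) 2 volume ∧ Function.support (u n) ⊆ Icc (-a) a)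
    (hconv : Tendsto (fun n ↦ ∫ x, ‖u n x - ξ x‖ ^ 2) atTop (𝓝 0)) (N : ℕ) :
    Tendsto (fun n ↦ bpart N (u n)) atTop (𝓝 (bpart N ξ)) := by
  have h0 := tendsto_weilMellin_real ha hξ hξs hu hconv 0
  have h1 := tendsto_weilMellin_real ha hξ hξs hu hconv 1
  simp only [Complex.ofReal_zero, Complex.ofReal_one] at h0 h1
  have hc : Tendsto (fun n ↦ conj (weilMellin (u n) 1)) atTop (𝓝 (conj (weilMellin ξ 1))) :=
    (Complex.continuous_conj.tendsto _).comp h1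
  have hP : Tendsto (fun n ↦ 2 * (weilMellin (u n) 0 * conj (weilMellin (u n) 1)).re) atTop
      (𝓝 (2 * (weilMellin ξ 0 * conj (weilMellin ξ 1)).re)) :=
    ((Complex.continuous_re.tendsto _).comp (h0.mul hc)).const_mul 2
  have hn2 := tendsto_weilNorm2Sq hξ hu hconv
  have hW := tendsto_integral_sqm_mul_bdd hξ hξs hu hconv
    (v := fun t ↦ reDigammaQuarter 0 - weilPrimeRipple N t)
    (measurable_const.sub (measurable_ripple N)) (abs_rdq0_sub_ripple_le N)
  unfold bpart
  exact (hP.sub (hn2.const_mul _)).add (hW.const_mul _)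

/-- **Fatou for the archimedean energy**: `A(ξ) ≤ liminf A(u_n)` (the weight `∂θ − ∂θ(0) ≥ 0` and
`û_n → ξ̂` pointwise). [cite: ConnesConsani2023, Prop. 2.1 (lower semicontinuity comes from Q_∞; arXiv chunk p0006:L55–L70; p. 103)] -/
private theorem archE_le_liminf (ha : 0 < a) (hξ : MemLp ξ 2 volume)
    (hξs : Function.support ξ ⊆ Icc (-a) a)
    (hu : ∀ n, MemLp (u n) 2 volume ∧ Function.support (u n) ⊆ Icc (-a) a)
    (hconv : Tendsto (fun n ↦ ∫ x, ‖u n x - ξ x‖ ^ 2) atTop (𝓝 0)) :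
    archE ξ ≤ liminf (fun n ↦ archE (u n)) atTop := by
  have hd := tendsto_integral_norm_sub ha hξ hξs hu hconv
  have hpt : ∀ t : ℝ, Tendsto (fun n ↦ weilMellin (u n) (1 / 2 + t * I)) atTop
      (𝓝 (weilMellin ξ (1 / 2 + t * I))) := by
    intro t
    rw [tendsto_iff_norm_sub_tendsto_zero]
    exact squeeze_zero (fun n ↦ norm_nonneg _)
      (fun n ↦ norm_weilMellin_half_line_sub_le (hu n).1 (hu n).2 hξ hξs t) hd
  have hpt' : ∀ t, Tendsto
      (fun n ↦ ENNReal.ofReal (sqm (u n) t * (reDigammaQuarter t - reDigammaQuarter 0))) atTop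
      (𝓝 (ENNReal.ofReal (sqm ξ t * (reDigammaQuarter t - reDigammaQuarter 0)))) := by
    intro t
    refine ENNReal.tendsto_ofReal ?_
    unfold sqm
    exact (((hpt t).norm).pow 2).mul_const _
  have hmeas : ∀ n, AEMeasurable
      (fun t ↦ ENNReal.ofReal (sqm (u n) t * (reDigammaQuarter t - reDigammaQuarter 0))) volume :=
    fun n ↦ (((continuous_sqm (integrable_of_memLp_window (hu n).1 (hu n).2)).measurable.mul
      (measurable_rdq.sub measurable_const)).ennreal_ofReal).aemeasurable
  unfold archE
  calc ∫⁻ t, ENNReal.ofReal (sqm ξ t * (reDigammaQuarter t - reDigammaQuarter 0))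
      = ∫⁻ t, liminf
          (fun n ↦ ENNReal.ofReal (sqm (u n) t * (reDigammaQuarter t - reDigammaQuarter 0))) atTop :=
        lintegral_congr fun t ↦ ((hpt' t).liminf_eq).symm
    _ ≤ liminf (fun n ↦ ∫⁻ t,
          ENNReal.ofReal (sqm (u n) t * (reDigammaQuarter t - reDigammaQuarter 0))) atTop :=
        lintegral_liminf_le' hmeas

end Continuity

/-! ## §H The discharge of `prop_2_1` -/

section Assembly

variable {a : ℝ}

/-- The extended form through the decomposition: for window-supported `η ∈ L²`,
`QW_λ(η) = B_N(η) + (1/2π) A(η)` if `A(η) < ∞` and `+∞` otherwise (`N = ⌊λ²⌋`). [cite: ConnesConsani2023, Prop. 2.1 eq. (2.11) (arXiv chunk p0006:L55–L81; p. 103–104)] -/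
private theorem semilocalWeilForm_eq_ite {η : ℝ → ℂ} (hη : MemLp η 2 volume)
    (hηs : Function.support η ⊆ Icc (-a) a) :
    semilocalWeilForm a η =
      if archE η < ∞ then
        ((bpart (primeCutoff a) η + 1 / (2 * π) * (archE η).toReal : ℝ) : EReal)
      else ⊤ := by
  have h1 := integrable_of_memLp_window hη hηs
  by_cases hA : archE η < ∞
  · have hE := energy_lt_top_of_archE h1 hη hA
    rw [if_pos hA, semilocalWeilForm_of_lt_top hE,
      weilFinitePrimeQuadratic_eq_bpart_add (primeCutoff a) h1 hη hE]
  · have hE : ¬ logSobolevEnergy η < ∞ := fun hE ↦ hA (archE_lt_top_of_energy hE)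
    rw [if_neg hA, semilocalWeilForm_of_not_lt_top hE]

/-- **Prop. 2.1, lower semicontinuity on `L²`** (clause (ii) of `prop_2_1`, PROVED): if `u_n → ξ` in
`L²` (all supported in the window) then `QW_λ(ξ) ≤ liminf QW_λ(u_n)`: the bounded part `B_N` is
continuous and the archimedean energy is lower semicontinuous by Fatou.
[cite: ConnesConsani2023, Prop. 2.1 (lower semi-continuous; arXiv chunk p0006:L55; p. 103)] -/
theorem semilocalWeilForm_le_liminf (ha : 0 < a) {ξ : ℝ → ℂ} {u : ℕ → ℝ → ℂ}
    (hξ : MemLp ξ 2 volume) (hξs : Function.support ξ ⊆ Icc (-a) a)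
    (hu : ∀ n, MemLp (u n) 2 volume ∧ Function.support (u n) ⊆ Icc (-a) a)
    (hconv : Tendsto (fun n ↦ ∫ x, ‖u n x - ξ x‖ ^ 2) atTop (𝓝 0)) :
    semilocalWeilForm a ξ ≤ liminf (fun n ↦ semilocalWeilForm a (u n)) atTop := by
  set N := primeCutoff a with hN
  have hB := tendsto_bpart ha hξ hξs hu hconv N
  have hAli := archE_le_liminf ha hξ hξs hu hconv
  have hFu : ∀ n, semilocalWeilForm a (u n) =
      if archE (u n) < ∞ then
        ((bpart N (u n) + 1 / (2 * π) * (archE (u n)).toReal : ℝ) : EReal) else ⊤ :=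
    fun n ↦ semilocalWeilForm_eq_ite (hu n).1 (hu n).2
  have hπ : 0 < 2 * π := by positivity
  refine le_of_forall_lt_imp_le_of_dense fun y hy ↦ ?_
  refine Filter.le_liminf_of_le (h := ?_)
  rw [semilocalWeilForm_eq_ite hξ hξs] at hy
  by_cases hAξ : archE ξ < ∞
  · rw [if_pos hAξ] at hy
    set x : ℝ := bpart N ξ + 1 / (2 * π) * (archE ξ).toReal with hx
    obtain ⟨q, hyq, hqx⟩ := EReal.lt_iff_exists_real_btwn.1 hy
    have hqx' : q < x := EReal.coe_lt_coe_iff.1 hqx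
    set ε : ℝ := x - q with hε
    have hεpos : 0 < ε := by linarith
    have hevB : ∀ᶠ n in atTop, bpart N ξ - ε / 2 < bpart N (u n) :=
      hB.eventually (lt_mem_nhds (by linarith))
    have hevA : ∀ᶠ n in atTop, archE (u n) < ∞ →
        (archE ξ).toReal - π * ε ≤ (archE (u n)).toReal := by
      by_cases h0 : archE ξ ≤ ENNReal.ofReal (π * ε)
      · refine Eventually.of_forall fun n _ ↦ ?_
        have h1 : (archE ξ).toReal ≤ π * ε := by
          have := ENNReal.toReal_mono ENNReal.ofReal_ne_top h0
          rwa [ENNReal.toReal_ofReal (by positivity)] at this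
        linarith [ENNReal.toReal_nonneg (a := archE (u n))]
      · rw [not_le] at h0
        set M := archE ξ - ENNReal.ofReal (π * ε) with hM
        have hMlt : M < archE ξ :=
          ENNReal.sub_lt_self hAξ.ne (ne_bot_of_gt h0) (by
            rw [ne_eq, ENNReal.ofReal_eq_zero, not_le]; positivity)
        have hev : ∀ᶠ n in atTop, M < archE (u n) :=
          Filter.eventually_lt_of_lt_liminf (hMlt.trans_le hAli)
        filter_upwards [hev] with n hn hfin
        have hle : M ≤ archE (u n) := hn.le
        have h2 := ENNReal.toReal_mono hfin.ne hle
        rw [hM, ENNReal.toReal_sub_of_le h0.le hAξ.ne, ENNReal.toReal_ofReal (by positivity)] at h2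
        exact h2
    filter_upwards [hevB, hevA] with n hBn hAn
    refine (le_of_lt hyq).trans ?_
    rw [hFu n]
    split_ifs with hfin
    · rw [EReal.coe_le_coe_iff]
      have hA' := hAn hfin
      have e : 1 / (2 * π) * (π * ε) = ε / 2 := by field_simp
      have : 1 / (2 * π) * ((archE ξ).toReal - π * ε) ≤ 1 / (2 * π) * (archE (u n)).toReal :=
        mul_le_mul_of_nonneg_left hA' (by positivity)
      rw [mul_sub, e] at this
      have hq : q = x - ε := by rw [hε]; ring
      rw [hq, hx]
      linarith
    · exact le_top
  · -- `A(ξ) = ∞`: the energies `A(u_n)` tend to `∞`, the bounded parts stay bounded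
    have hAtop : archE ξ = ⊤ := not_lt_top_iff.1 hAξ
    obtain ⟨r, hyr, -⟩ := EReal.lt_iff_exists_real_btwn.1 hy
    refine Filter.Eventually.mono ?_ fun n (hn : ((r : ℝ) : EReal) ≤ semilocalWeilForm a (u n)) ↦
      (le_of_lt hyr).trans hn
    set R : ℝ := max (r - bpart N ξ + 1) 0 with hR
    have hRnn : 0 ≤ R := le_max_right _ _
    have hMlt : ENNReal.ofReal (2 * π * R) < archE ξ := by rw [hAtop]; exact ENNReal.ofReal_lt_top
    have hevA : ∀ᶠ n in atTop, ENNReal.ofReal (2 * π * R) < archE (u n) :=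
      Filter.eventually_lt_of_lt_liminf (hMlt.trans_le hAli)
    have hevB : ∀ᶠ n in atTop, bpart N ξ - 1 < bpart N (u n) :=
      hB.eventually (lt_mem_nhds (by linarith))
    filter_upwards [hevA, hevB] with n hAn hBn
    rw [hFu n]
    split_ifs with hfin
    · rw [EReal.coe_le_coe_iff]
      have h2 := ENNReal.toReal_mono hfin.ne hAn.le
      rw [ENNReal.toReal_ofReal (by positivity)] at h2
      have h3 : R ≤ 1 / (2 * π) * (archE (u n)).toReal := by
        have e2 : 1 / (2 * π) * (2 * π * R) = R := by field_simp
        calc R = 1 / (2 * π) * (2 * π * R) := e2.symm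
          _ ≤ 1 / (2 * π) * (archE (u n)).toReal := mul_le_mul_of_nonneg_left h2 (by positivity)
      have h4 : r - bpart N ξ + 1 ≤ R := le_max_left _ _
      linarith
    · exact le_top

/-- **Discharge of `prop_2_1`**: the `L²`-extension clause of Connes–Consani 2023, Prop. 2.1 — the
semi-local Weil quadratic form `QW_λ` (the tree's `semilocalWeilForm (log λ)`) is lower bounded and lower
semicontinuous on the window-supported square-integrable functions, for every `λ > 1`.
RH-FREE functional analysis. [cite: ConnesConsani2023, Prop. 2.1 (arXiv chunk p0006:L55; p. 103)] -/
theorem prop_2_1_holds : prop_2_1 := by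
  intro a ha
  exact ⟨semilocalWeilForm_lower_bound ha,
    fun ξ u hξ hξs hu hconv ↦ semilocalWeilForm_le_liminf ha hξ hξs hu hconv⟩

end Assembly

/-! ## §I Continuity of `E_N` for the graph norm `‖ξ‖² + ‖ξ̂‖₁²` (energy convergence) -/

section GraphNorm

variable {a : ℝ} {ξ : ℝ → ℂ} {u : ℕ → ℝ → ℂ}

/-- `1 ≤ 1 + log(1 + t²)`. [cite: ConnesConsani2023, Lemma 2.2 (the norm ‖ξ‖₁² of (2.14); arXiv chunk p0007:L5; p. 104)] -/
private theorem one_le_logWeight (t : ℝ) : 1 ≤ 1 + Real.log (1 + t ^ 2) := by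
  have := Real.log_nonneg (show (1 : ℝ) ≤ 1 + t ^ 2 by nlinarith [sq_nonneg t])
  linarith

/-- **`2π ‖η‖₂² ≤ ‖η̂‖₁²`** for `η ∈ L¹ ∩ L²` (Plancherel and `1 + log(1+t²) ≥ 1`): the graph norm of
Lemma 2.2 dominates the `L²` norm. [cite: ConnesConsani2023, Lemma 2.2 (core for the graph norm ‖ξ‖² + ‖ξ̂‖₁², (2.14); arXiv chunk p0007:L1–L9; p. 104)] -/
theorem ofReal_two_pi_mul_integral_norm_sq_le_logSobolevEnergy {η : ℝ → ℂ} (h1 : Integrable η)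
    (h2 : MemLp η 2 volume) :
    ENNReal.ofReal (2 * π * ∫ x, ‖η x‖ ^ 2) ≤ logSobolevEnergy η := by
  rw [← integral_norm_sq_weilMellin_half_line_of_memLp h1 h2,
    ofReal_integral_eq_lintegral_ofReal (integrable_norm_sq_weilMellin_half_line_of_memLp h1 h2)
      (Eventually.of_forall fun t ↦ sq_nonneg _)]
  unfold logSobolevEnergy
  refine lintegral_mono fun t ↦ ENNReal.ofReal_le_ofReal ?_
  calc ‖weilMellin η (1 / 2 + t * I)‖ ^ 2 = ‖weilMellin η (1 / 2 + t * I)‖ ^ 2 * 1 := (mul_one _).symm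
    _ ≤ ‖weilMellin η (1 / 2 + t * I)‖ ^ 2 * (1 + Real.log (1 + t ^ 2)) :=
        mul_le_mul_of_nonneg_left (one_le_logWeight t) (sq_nonneg _)

/-- **Energy convergence implies `L²` convergence** on the window: if `‖(u_n − ξ)^‖₁² → 0` then
`∫ |u_n − ξ|² → 0`. [cite: ConnesConsani2023, proof of Prop. 2.3 (F is continuous for the graph norm; arXiv chunk p0007:L70–L72; p. 106)] -/
theorem tendsto_integral_norm_sq_sub_of_energy (hξ : MemLp ξ 2 volume)
    (hξs : Function.support ξ ⊆ Icc (-a) a)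
    (hu : ∀ n, MemLp (u n) 2 volume ∧ Function.support (u n) ⊆ Icc (-a) a)
    (hconv : Tendsto (fun n ↦ logSobolevEnergy (fun x ↦ u n x - ξ x)) atTop (𝓝 0)) :
    Tendsto (fun n ↦ ∫ x, ‖u n x - ξ x‖ ^ 2) atTop (𝓝 0) := by
  have hR : Tendsto (fun n ↦ (logSobolevEnergy (fun x ↦ u n x - ξ x)).toReal) atTop (𝓝 0) := by
    have h := (ENNReal.tendsto_toReal ENNReal.zero_ne_top).comp hconv
    rwa [ENNReal.toReal_zero] at h
  have hfin : ∀ᶠ n in atTop, logSobolevEnergy (fun x ↦ u n x - ξ x) < ∞ :=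
    hconv.eventually (gt_mem_nhds ENNReal.zero_lt_top)
  have hπ : (0 : ℝ) < 2 * π := by positivity
  refine squeeze_zero' (Eventually.of_forall fun n ↦ integral_nonneg fun _ ↦ by positivity)
    (hfin.mono fun n hn ↦ ?_) (by simpa using hR.div_const (2 * π))
  have hd : MemLp (fun x ↦ u n x - ξ x) 2 volume := (hu n).1.sub hξ
  have hds := support_sub_subset_window (hu n).2 hξs
  have h := ofReal_two_pi_mul_integral_norm_sq_le_logSobolevEnergy
    (integrable_of_memLp_window hd hds) hd
  rw [le_div_iff₀ hπ, mul_comm]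
  exact (ENNReal.ofReal_le_iff_le_toReal hn.ne).1 h

/-- `A(η) ≤ K ‖η̂‖₁²` (`∂θ − ∂θ(0) ≤ K · (1 + log(1+t²))`). [cite: ConnesConsani2023, proof of Lemma 2.2 ((2.14) ⇔ (2.16) via the asymptotics of ∂θ; arXiv chunk p0007:L16–L22; p. 105)] -/
private theorem exists_archE_le_mul_energy :
    ∃ K : ℝ, 0 < K ∧ ∀ η : ℝ → ℂ, archE η ≤ ENNReal.ofReal K * logSobolevEnergy η := by
  obtain ⟨K, hK, hKb⟩ := exists_reDigammaQuarter_sub_le_logWeight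
  refine ⟨K, hK, fun η ↦ ?_⟩
  unfold archE logSobolevEnergy
  rw [← lintegral_const_mul' _ _ ENNReal.ofReal_ne_top]
  refine lintegral_mono fun t ↦ ?_
  rw [← ENNReal.ofReal_mul hK.le]
  refine ENNReal.ofReal_le_ofReal ?_
  show sqm η t * _ ≤ K * (‖weilMellin η (1 / 2 + t * I)‖ ^ 2 * _)
  have h0 := sqm_nonneg η t
  unfold sqm at h0 ⊢
  calc ‖weilMellin η (1 / 2 + t * I)‖ ^ 2 * (reDigammaQuarter t - reDigammaQuarter 0)
      ≤ ‖weilMellin η (1 / 2 + t * I)‖ ^ 2 * (K * (1 + Real.log (1 + t ^ 2))) :=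
        mul_le_mul_of_nonneg_left (hKb t) h0
    _ = K * (‖weilMellin η (1 / 2 + t * I)‖ ^ 2 * (1 + Real.log (1 + t ^ 2))) := by ring

/-- On the domain, `A(η)` as a Bochner integral. [cite: ConnesConsani2023, proof of Lemma 2.2 (Q_∞(ξ,ξ) < ∞ on the domain; arXiv chunk p0007:L3; p. 104)] -/
private theorem integral_sqm_mul_rdq_sub_eq {η : ℝ → ℂ} (h1 : Integrable η)
    (hE : logSobolevEnergy η < ∞) :
    ∫ t, sqm η t * (reDigammaQuarter t - reDigammaQuarter 0) = (archE η).toReal := by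
  unfold archE
  exact integral_eq_lintegral_of_nonneg_ae
    (Eventually.of_forall fun t ↦ mul_nonneg (sqm_nonneg η t) (rdq_sub_nonneg t))
    (integrable_sqm_mul_rdq_sub h1 hE).1

/-- The key estimate `|A(η) − A(ξ)| ≤ (1 + 1/δ) A(η − ξ) + δ A(ξ)` on the domain (`δ > 0`).
[cite: ConnesConsani2023, proof of Prop. 2.3 (F is continuous on Dom(Q^N_{W,λ}) for the graph norm; arXiv chunk p0007:L70–L72; p. 106)] -/
private theorem abs_archE_toReal_sub_le (hξ : MemLp ξ 2 volume)
    (hξs : Function.support ξ ⊆ Icc (-a) a) (hEξ : logSobolevEnergy ξ < ∞) {η : ℝ → ℂ}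
    (hη : MemLp η 2 volume) (hηs : Function.support η ⊆ Icc (-a) a)
    (hEd : logSobolevEnergy (fun x ↦ η x - ξ x) < ∞) (hEη : logSobolevEnergy η < ∞)
    {δ : ℝ} (hδ : 0 < δ) :
    |(archE η).toReal - (archE ξ).toReal| ≤
      (1 + 1 / δ) * (archE (fun x ↦ η x - ξ x)).toReal + δ * (archE ξ).toReal := by
  have hξ1 := integrable_of_memLp_window hξ hξs
  have hη1 := integrable_of_memLp_window hη hηs
  have hd : MemLp (fun x ↦ η x - ξ x) 2 volume := hη.sub hξ
  have hds := support_sub_subset_window hηs hξs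
  have hd1 := integrable_of_memLp_window hd hds
  have hIξ := integrable_sqm_mul_rdq_sub hξ1 hEξ
  have hIη := integrable_sqm_mul_rdq_sub hη1 hEη
  have hId := integrable_sqm_mul_rdq_sub hd1 hEd
  rw [← integral_sqm_mul_rdq_sub_eq hξ1 hEξ, ← integral_sqm_mul_rdq_sub_eq hη1 hEη,
    ← integral_sqm_mul_rdq_sub_eq hd1 hEd, ← integral_sub hIη hIξ, ← integral_const_mul,
    ← integral_const_mul, ← integral_add (hId.const_mul _) (hIξ.const_mul _)]
  refine abs_integral_le_integral_abs.trans (integral_mono_of_nonneg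
    (Eventually.of_forall fun _ ↦ abs_nonneg _) ((hId.const_mul _).add (hIξ.const_mul _))
    (Eventually.of_forall fun t ↦ ?_))
  have hw := rdq_sub_nonneg t
  have hpt : |sqm η t - sqm ξ t| ≤ (1 + 1 / δ) * sqm (fun x ↦ η x - ξ x) t + δ * sqm ξ t := by
    unfold sqm
    rw [weilMellin_sub_window hη hηs hξ hξs]
    exact abs_sq_norm_sub_sq_norm_le _ _ hδ
  show |sqm η t * _ - sqm ξ t * _| ≤ (1 + 1 / δ) * (sqm (fun x ↦ η x - ξ x) t * _) + δ * (sqm ξ t * _)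
  rw [← sub_mul, abs_mul, abs_of_nonneg hw]
  calc |sqm η t - sqm ξ t| * (reDigammaQuarter t - reDigammaQuarter 0)
      ≤ ((1 + 1 / δ) * sqm (fun x ↦ η x - ξ x) t + δ * sqm ξ t) *
          (reDigammaQuarter t - reDigammaQuarter 0) := mul_le_mul_of_nonneg_right hpt hw
    _ = _ := by ring

/-- **Continuity of the archimedean energy for the graph norm**: on the domain, `‖(u_n − ξ)^‖₁² → 0`
implies `A(u_n) → A(ξ)`. [cite: ConnesConsani2023, proof of Prop. 2.3 (F is continuous on Dom(Q^N_{W,λ}) for the graph norm; arXiv chunk p0007:L70–L72; p. 106)] -/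
private theorem tendsto_archE_toReal_of_energy (hξ : ξ ∈ formDomain a)
    (hu : ∀ n, u n ∈ formDomain a)
    (hconv : Tendsto (fun n ↦ logSobolevEnergy (fun x ↦ u n x - ξ x)) atTop (𝓝 0)) :
    Tendsto (fun n ↦ (archE (u n)).toReal) atTop (𝓝 (archE ξ).toReal) := by
  obtain ⟨K, hK, hKb⟩ := exists_archE_le_mul_energy
  rw [Metric.tendsto_atTop]
  intro ε hε
  set A := (archE ξ).toReal with hA
  have hA0 : 0 ≤ A := ENNReal.toReal_nonneg
  set δ : ℝ := ε / (2 * (A + 1)) with hδ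
  have hδpos : 0 < δ := by positivity
  have hδA : δ * A ≤ ε / 2 := by
    rw [hδ, div_mul_eq_mul_div, div_le_iff₀ (by positivity)]
    nlinarith
  have hR : Tendsto (fun n ↦ (logSobolevEnergy (fun x ↦ u n x - ξ x)).toReal) atTop (𝓝 0) := by
    have h := (ENNReal.tendsto_toReal ENNReal.zero_ne_top).comp hconv
    rwa [ENNReal.toReal_zero] at h
  have hev1 : ∀ᶠ n in atTop,
      (1 + 1 / δ) * (K * (logSobolevEnergy (fun x ↦ u n x - ξ x)).toReal) < ε / 2 := by
    have ht : Tendsto (fun n ↦ (1 + 1 / δ) * (K * (logSobolevEnergy (fun x ↦ u n x - ξ x)).toReal))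
        atTop (𝓝 0) := by
      simpa using (hR.const_mul K).const_mul (1 + 1 / δ)
    exact ht.eventually (gt_mem_nhds (by positivity))
  have hev2 : ∀ᶠ n in atTop, logSobolevEnergy (fun x ↦ u n x - ξ x) < ∞ :=
    hconv.eventually (gt_mem_nhds ENNReal.zero_lt_top)
  obtain ⟨N, hN⟩ := eventually_atTop.1 (hev1.and hev2)
  refine ⟨N, fun n hn ↦ ?_⟩
  obtain ⟨h1, h2⟩ := hN n hn
  rw [Real.dist_eq]
  have hle := abs_archE_toReal_sub_le hξ.1 hξ.2.1 hξ.2.2 (hu n).1 (hu n).2.1 h2 (hu n).2.2 hδpos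
  have hAd : (archE (fun x ↦ u n x - ξ x)).toReal ≤
      K * (logSobolevEnergy (fun x ↦ u n x - ξ x)).toReal := by
    calc (archE (fun x ↦ u n x - ξ x)).toReal
        ≤ (ENNReal.ofReal K * logSobolevEnergy (fun x ↦ u n x - ξ x)).toReal :=
          ENNReal.toReal_mono (ENNReal.mul_ne_top ENNReal.ofReal_ne_top h2.ne) (hKb _)
      _ = K * (logSobolevEnergy (fun x ↦ u n x - ξ x)).toReal := by
          rw [ENNReal.toReal_mul, ENNReal.toReal_ofReal hK.le]
  have h1δ : 0 ≤ 1 + 1 / δ := by positivity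
  calc |(archE (u n)).toReal - A|
      ≤ (1 + 1 / δ) * (archE (fun x ↦ u n x - ξ x)).toReal + δ * A := hle
    _ ≤ (1 + 1 / δ) * (K * (logSobolevEnergy (fun x ↦ u n x - ξ x)).toReal) + δ * A := by
        gcongr
    _ < ε / 2 + ε / 2 := add_lt_add_of_lt_of_le h1 hδA
    _ = ε := by ring

/-- **`F = QW_λ` is continuous on `Dom(Q^N_{W,λ})` for the graph norm** (PROVED): if `ξ` and the `u_n`
lie in the form domain and `‖(u_n − ξ)^‖₁² → 0`, then `E_N(u_n) → E_N(ξ)` for every `N` — the bounded part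
`B_N` is `L²`-continuous (`tendsto_bpart`, and energy convergence implies `L²` convergence) and the
archimedean energy is continuous for the weighted norm. [cite: ConnesConsani2023, proof of Prop. 2.3 («F is continuous on Dom(Q^N_{W,λ}) for the graph norm»; arXiv chunk p0007:L70–L72; p. 106)] -/
theorem tendsto_weilFinitePrimeQuadratic_of_energy (ha : 0 < a) (hξ : ξ ∈ formDomain a)
    (hu : ∀ n, u n ∈ formDomain a)
    (hconv : Tendsto (fun n ↦ logSobolevEnergy (fun x ↦ u n x - ξ x)) atTop (𝓝 0)) (N : ℕ) :
    Tendsto (fun n ↦ weilFinitePrimeQuadratic N (u n)) atTop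
      (𝓝 (weilFinitePrimeQuadratic N ξ)) := by
  have hu' : ∀ n, MemLp (u n) 2 volume ∧ Function.support (u n) ⊆ Icc (-a) a :=
    fun n ↦ ⟨(hu n).1, (hu n).2.1⟩
  have hL2 := tendsto_integral_norm_sq_sub_of_energy hξ.1 hξ.2.1 hu' hconv
  have hB := tendsto_bpart ha hξ.1 hξ.2.1 hu' hL2 N
  have hA := tendsto_archE_toReal_of_energy hξ hu hconv
  have e : ∀ η : ℝ → ℂ, η ∈ formDomain a →
      weilFinitePrimeQuadratic N η = bpart N η + 1 / (2 * π) * (archE η).toReal := fun η hη ↦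
    weilFinitePrimeQuadratic_eq_bpart_add N (integrable_of_memLp_window hη.1 hη.2.1) hη.1 hη.2.2
  have eu : (fun n ↦ weilFinitePrimeQuadratic N (u n)) =
      fun n ↦ bpart N (u n) + 1 / (2 * π) * (archE (u n)).toReal := funext fun n ↦ e _ (hu n)
  rw [eu, e ξ hξ]
  exact hB.add (hA.const_mul _)

/-- **Continuity of `QW_λ` on its domain for the graph norm** (`EReal`-valued form): under the hypotheses
of `tendsto_weilFinitePrimeQuadratic_of_energy`, `QW_λ(u_n) → QW_λ(ξ)`. [cite: ConnesConsani2023, proof of Prop. 2.3 («F is continuous on Dom(Q^N_{W,λ}) for the graph norm»; arXiv chunk p0007:L70–L72; p. 106)] -/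
theorem tendsto_semilocalWeilForm_of_energy (ha : 0 < a) (hξ : ξ ∈ formDomain a)
    (hu : ∀ n, u n ∈ formDomain a)
    (hconv : Tendsto (fun n ↦ logSobolevEnergy (fun x ↦ u n x - ξ x)) atTop (𝓝 0)) :
    Tendsto (fun n ↦ semilocalWeilForm a (u n)) atTop (𝓝 (semilocalWeilForm a ξ)) := by
  have h := tendsto_weilFinitePrimeQuadratic_of_energy ha hξ hu hconv (primeCutoff a)
  have eu : (fun n ↦ semilocalWeilForm a (u n)) =
      fun n ↦ ((weilFinitePrimeQuadratic (primeCutoff a) (u n) : ℝ) : EReal) :=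
    funext fun n ↦ semilocalWeilForm_of_mem_formDomain (hu n)
  rw [eu, semilocalWeilForm_of_mem_formDomain hξ]
  exact (continuous_coe_real_ereal.tendsto _).comp h

end GraphNorm

end Literature.NumberTheory.ConnesConsani2023

end
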